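import Literature.Geometry.Lorentzian.CoordParallelFrames
import Literature.Geometry.Riemannian.HamiltonMaximumPrincipleTools
import Literature.Geometry.Riemannian.HamiltonReactionIdentity
import Mathlib.Topology.UniformSpace.HeineCantor
import HarnessLib

/-!
# The spatial step of Hamilton's maximum principle: the Laplacian of the curvature points into the convex set

For the proof of the named fact `Literature.Geometry.Riemannian.hamilton_maximumPrinciple_curvatureODE`
(`HamiltonCurvatureODE.lean`; Hamilton 1986, §4, Thm. 4.3): the convexity part of Hamilton's
argument (§4, proof of Lemma 4.2, p. 162: along geodesics with parallel frames the components of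
`M` have second derivative the components of `∇²M`; since all values lie in the convex set, the
Laplacian `ΔM = tr ∇²M` points into it), in the quantitative, frame-wise form used by the tree's
proof and WITHOUT tangent cones, through the second-order midpoint estimate of
`HamiltonMaximumPrincipleTools.lean`:

* `HamiltonMP.exists_pos_le_quadratic` — uniform positive-definiteness `λ‖v‖² ≤ G_y(v,v)` of
  positive definite metric components over a compact set (so that orthonormal frames are bounded,
  `MetricCoord.IsONFrame.norm_le`);
* **`HamiltonMP.spatial_estimate`** — for metric components `G` on `V ⊇ K` (compact), dimension
  `4`, and a continuous linear reading `Φ` of component arrays in a normed space: for every `η > 0`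
  there is `h₀ > 0` such that for every `G_y`-orthonormal `4`-frame `W` at `y ∈ K`, every
  `h ∈ (0, h₀]`, every convex `C` and every `D ≥ 0` bounding the distance to `C` of the readings of
  the curvature components on ALL orthonormal frames at points of `V`,
  `dist(Φ(r) + h Φ(Δr), C) ≤ D + h η`, where `r = rmComp G y W` and
  `Δr = lapComp G y W = Σ_i (∇²_{W_i,W_i} Rm)(W,W,W,W)` (`HamiltonReactionIdentity.lean`).
  Proof: geodesics `γ_i` in the directions `W_i` with parallel frames (`CoordParallelFrames.lean`)
  give curves `m_i(s) = Φ(Rm_{γ_i(s)}(W,W,W,W))` inside the closed convex `D`-neighbourhood of `C`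
  with `m_i''(0) = Φ((∇²_{W_i,W_i}Rm)(…))` (uniform modulus from the compact family of frames);
  the midpoint estimate and Jensen's inequality for the distance to a convex set conclude.

Everything is proved; no definition of `Prop` type is introduced.

## References

* R. S. Hamilton, *Four-manifolds with positive curvature operator*, J. Differential Geom. 24
  (1986) 153–179, §4, Lemma 4.1, Lemma 4.2, Thm. 4.3 (pp. 160–162). [Hamilton1986]
* B. Chow, P. Lu, Pacific J. Math. 214 (2004), §2, Thm. 3. [ChowLu2004]
-/

noncomputable section

set_option maxSynthPendingDepth 3

open Set Filter Metric ContinuousLinearMap Module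
open scoped Topology ContDiff NNReal

namespace Literature.Geometry.Riemannian

namespace HamiltonMP

open Lorentzian Lorentzian.MetricCoord CurvComp

variable {E : Type*} [NormedAddCommGroup E] [NormedSpace ℝ E] [FiniteDimensional ℝ E] [CompleteSpace E]
  {F : Type*} [NormedAddCommGroup F] [NormedSpace ℝ F]
  {G : E → E →L[ℝ] E →L[ℝ] ℝ} {V K : Set E}

/-! ### Uniform positive-definiteness over a compact set -/

omit [CompleteSpace E] in
/-- **Uniform positive-definiteness of a continuous compact family of positive definite forms**:
`λ‖v‖² ≤ B_p(v,v)` for all `p ∈ P` and all `v`, for some `λ > 0` (minimum over `P ×` the unit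
sphere). [cite: Hamilton1997, §2.1, p. 8] -/
theorem exists_pos_le_quadratic_of_isCompact {X : Type*} [TopologicalSpace X] {B : X → E →L[ℝ] E →L[ℝ] ℝ}
    {P : Set X} (hP : IsCompact P) (hB : ContinuousOn B P)
    (hpos : ∀ p ∈ P, ∀ v : E, v ≠ 0 → 0 < B p v v) :
    ∃ lam > 0, ∀ p ∈ P, ∀ v : E, lam * ‖v‖ ^ 2 ≤ B p v v := by
  set S : Set (X × E) := P ×ˢ sphere (0 : E) 1 with hS
  have hSc : IsCompact S := hP.prod (isCompact_sphere _ _)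
  have hf : ContinuousOn (fun q : X × E ↦ B q.1 q.2 q.2) S := by
    have h1 : ContinuousOn (fun q : X × E ↦ B q.1) S := hB.comp continuous_fst.continuousOn fun q hq ↦ hq.1
    exact (h1.clm_apply continuous_snd.continuousOn).clm_apply continuous_snd.continuousOn
  -- scaling: it suffices to bound on the unit sphere
  have key : ∀ lam : ℝ, (∀ q ∈ S, lam ≤ B q.1 q.2 q.2) → ∀ p ∈ P, ∀ v : E, lam * ‖v‖ ^ 2 ≤ B p v v := by
    intro lam hlam p hp v
    by_cases hv : v = 0
    · subst hv; simp
    · have hn : 0 < ‖v‖ := norm_pos_iff.2 hv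
      set w : E := ‖v‖⁻¹ • v with hw
      have hwS : (p, w) ∈ S := by
        refine ⟨hp, ?_⟩
        rw [mem_sphere_zero_iff_norm, hw, norm_smul, norm_inv, norm_norm, inv_mul_cancel₀ hn.ne']
      have h1 := hlam (p, w) hwS
      have hvw : v = ‖v‖ • w := by rw [hw, smul_smul, mul_inv_cancel₀ hn.ne', one_smul]
      have h2 : B p v v = ‖v‖ ^ 2 * B p w w := by
        conv_lhs => rw [hvw]
        simp only [map_smul, _root_.smul_apply, smul_eq_mul]; ring
      rw [h2]
      nlinarith [sq_nonneg ‖v‖, h1, mul_le_mul_of_nonneg_left h1 (sq_nonneg ‖v‖)]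
  rcases S.eq_empty_or_nonempty with hSe | hSne
  · exact ⟨1, one_pos, key 1 fun q hq ↦ by rw [hSe] at hq; exact hq.elim⟩
  · obtain ⟨q₀, hq₀, hmin⟩ := hSc.exists_isMinOn hSne hf
    have hq₀pos : 0 < B q₀.1 q₀.2 q₀.2 := by
      refine hpos q₀.1 hq₀.1 q₀.2 ?_
      have : ‖q₀.2‖ = 1 := mem_sphere_zero_iff_norm.1 hq₀.2
      rintro h; rw [h, norm_zero] at this; exact zero_ne_one this
    exact ⟨B q₀.1 q₀.2 q₀.2, hq₀pos, key _ fun q hq ↦ hmin hq⟩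

omit [CompleteSpace E] in
/-- **Uniform positive-definiteness over a compact set**: if the metric components are positive
definite on `V ⊇ K`, `K` compact, there is `λ > 0` with `λ‖v‖² ≤ G_y(v,v)` for all `y ∈ K` and
all `v`. [cite: Hamilton1997, §2.1, p. 8] -/
theorem exists_pos_le_quadratic (hG : IsMetricOn G V) (hpos : ∀ y ∈ V, ∀ v : E, v ≠ 0 → 0 < G y v v)
    (hK : IsCompact K) (hKV : K ⊆ V) :
    ∃ lam > 0, ∀ y ∈ K, ∀ v : E, lam * ‖v‖ ^ 2 ≤ G y v v :=
  exists_pos_le_quadratic_of_isCompact hK (hG.contDiffOn.continuousOn.mono hKV) fun y hy ↦ hpos y (hKV hy)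

/-! ### The second covariant derivative of the curvature as an array-valued map -/

/-- The array `(a,b,c,d) ↦ G_y((∇²_{u,u}R)(W_a,W_b)W_c, W_d)` as a function of the state
`(y, u, W)` of the geodesic / parallel-transport system. [cite: Hamilton1986, §4, p. 162] -/
def cov2Arr (G : E → E →L[ℝ] E →L[ℝ] ℝ) (q : E × E × (Fin 4 → E)) : Comp :=
  fun a b c d ↦ G q.1 (cov2RiemAt G q.1 q.2.1 q.2.1 (q.2.2 a) (q.2.2 b) (q.2.2 c)) (q.2.2 d)

omit [FiniteDimensional ℝ E] in
/-- `cov2Arr` is continuous on `{(y,u,W) : y ∈ V}`. [folklore] -/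
theorem continuousOn_cov2Arr (hG : IsMetricOn G V) :
    ContinuousOn (cov2Arr G) {q : E × E × (Fin 4 → E) | q.1 ∈ V} :=
  continuousOn_pi.2 fun a ↦ continuousOn_pi.2 fun b ↦ continuousOn_pi.2 fun c ↦
    continuousOn_pi.2 fun d ↦ hG.continuousOn_cov2Form a b c d

omit [FiniteDimensional ℝ E] [CompleteSpace E] in
/-- The Laplacian array of an orthonormal frame is the sum over the frame directions of
`cov2Arr` at the initial states `(y, W_i, W)`. [cite: Topping2006, §2.4, (2.4.1)] -/
theorem lapComp_eq_sum_cov2Arr (y : E) (W : Fin 4 → E) :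
    lapComp G y W = ∑ i, cov2Arr G (y, W i, W) := by
  funext a b c d
  simp only [lapComp, cov2Arr, Finset.sum_apply]

omit [FiniteDimensional ℝ E] in
/-- Joint continuity of a component of the Laplacian array `(y, W) ↦ lapComp G y W a b c d` on
`{y ∈ V}` (through `IsMetricOn.continuousOn_cov2Form`). [cite: Topping2006, §2.4, (2.4.1)] -/
theorem continuousOn_lapComp_apply (hG : IsMetricOn G V) (a b c d : Fin 4) :
    ContinuousOn (fun q : E × (Fin 4 → E) ↦ lapComp G q.1 q.2 a b c d) (Prod.fst ⁻¹' V) := by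
  have hterm : ∀ i : Fin 4, ContinuousOn (fun q : E × (Fin 4 → E) ↦
      G q.1 (cov2RiemAt G q.1 (q.2 i) (q.2 i) (q.2 a) (q.2 b) (q.2 c)) (q.2 d)) (Prod.fst ⁻¹' V) := by
    intro i
    have hWi : Continuous fun q : E × (Fin 4 → E) ↦ q.2 i := (continuous_apply i).comp continuous_snd
    have hci : Continuous fun q : E × (Fin 4 → E) ↦ ((q.1, (q.2 i, q.2)) : E × E × (Fin 4 → E)) :=
      continuous_fst.prodMk (hWi.prodMk continuous_snd)
    have hmaps : MapsTo (fun q : E × (Fin 4 → E) ↦ ((q.1, (q.2 i, q.2)) : E × E × (Fin 4 → E)))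
        (Prod.fst ⁻¹' V) {q : E × E × (Fin 4 → E) | q.1 ∈ V} := fun q hq ↦ hq
    have h2 := (hG.continuousOn_cov2Form a b c d).comp (hci.continuousOn (s := Prod.fst ⁻¹' V)) hmaps
    simp only [Function.comp_def] at h2
    exact h2
  have h := continuousOn_finsetSum (Finset.univ : Finset (Fin 4)) fun i _ ↦ hterm i
  exact h

omit [FiniteDimensional ℝ E] in
/-- **Joint continuity of the Laplacian array** `(y, W) ↦ lapComp G y W` on `{y ∈ V}`.
[cite: Topping2006, §2.4, (2.4.1)] -/
theorem continuousOn_lapComp (hG : IsMetricOn G V) :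
    ContinuousOn (fun q : E × (Fin 4 → E) ↦ lapComp G q.1 q.2) (Prod.fst ⁻¹' V) :=
  continuousOn_pi.2 fun a ↦ continuousOn_pi.2 fun b ↦ continuousOn_pi.2 fun c ↦
    continuousOn_pi.2 fun d ↦ continuousOn_lapComp_apply hG a b c d

/-! ### Solutions of the geodesic / parallel-transport system: components and orthonormality -/

section Curves

variable {q : ℝ → E × E × (Fin 4 → E)} {σ : ℝ}

omit [FiniteDimensional ℝ E] [CompleteSpace E] in
/-- Components of a solution of the system: `γ' = u`, `u' = −Γ(u,u)`, `W'_j = −Γ(u, W_j)`. [folklore] -/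
theorem hasDerivAt_components (h : HasDerivAt q (geoField G (q σ)) σ) :
    HasDerivAt (fun τ ↦ (q τ).1) ((q σ).2.1) σ ∧
      HasDerivAt (fun τ ↦ (q τ).2.1) (-chrAt G (q σ).1 (q σ).2.1 (q σ).2.1) σ ∧
      ∀ j, HasDerivAt (fun τ ↦ (q τ).2.2 j) (-chrAt G (q σ).1 (q σ).2.1 ((q σ).2.2 j)) σ := by
  refine ⟨?_, ?_, fun j ↦ ?_⟩
  · exact ((ContinuousLinearMap.fst ℝ E (E × (Fin 4 → E))).hasFDerivAt.comp_hasDerivAt σ h :)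
  · exact (((ContinuousLinearMap.fst ℝ E (Fin 4 → E)).comp
      (ContinuousLinearMap.snd ℝ E (E × (Fin 4 → E)))).hasFDerivAt.comp_hasDerivAt σ h :)
  · exact (((ContinuousLinearMap.proj j : (Fin 4 → E) →L[ℝ] E).comp
      ((ContinuousLinearMap.snd ℝ E (Fin 4 → E)).comp
        (ContinuousLinearMap.snd ℝ E (E × (Fin 4 → E))))).hasFDerivAt.comp_hasDerivAt σ h :)

end Curves

/-! ### The spatial estimate -/

/-- **The Laplacian of the curvature points into the convex set — quantitative frame form**
(Hamilton 1986, §4, proof of Lemma 4.2 / Thm. 4.3, p. 162, via the midpoint estimate instead of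
tangent cones). Let `G` be positive definite metric components on the open set `V` of a
finite-dimensional space, `K ⊆ V` compact, and `Φ` a continuous linear reading of component arrays
in a normed space `F`. For every `η > 0` there is `h₀ > 0` such that: for every `y ∈ K`, every
`G_y`-orthonormal `4`-frame `W`, every `h ∈ (0, h₀]`, every convex `C ⊆ F` and every `D ≥ 0` with
`dist(Φ(Rm_{y'}(W',W',W',W')), C) ≤ D` for ALL orthonormal `4`-frames `W'` at points `y' ∈ V`,
one has `dist(Φ(r) + h • Φ(Δr), C) ≤ D + h η` (`r = rmComp G y W`, `Δr = lapComp G y W`).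
[cite: Hamilton1986, §4, Lemma 4.2] -/
theorem spatial_estimate (hG : IsMetricOn G V) (hpos : ∀ y ∈ V, ∀ v : E, v ≠ 0 → 0 < G y v v)
    (hK : IsCompact K) (hKV : K ⊆ V) (Φ : Comp →L[ℝ] F) {η : ℝ} (hη : 0 < η) :
    ∃ h₀ > 0, ∀ y ∈ K, ∀ W : Fin 4 → E, IsONFrame (G y) W → ∀ h ∈ Ioc (0 : ℝ) h₀,
      ∀ C : Set F, Convex ℝ C → ∀ D : ℝ, 0 ≤ D →
        (∀ y' ∈ V, ∀ W' : Fin 4 → E, IsONFrame (G y') W' → infDist (Φ (rmComp G y' W')) C ≤ D) →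
        infDist (Φ (rmComp G y W) + h • Φ (lapComp G y W)) C ≤ D + h * η := by
  classical
  -- (1) frames over `K` are bounded
  obtain ⟨lam, hlam, hlamK⟩ := exists_pos_le_quadratic hG hpos hK hKV
  set R : ℝ := (Real.sqrt lam)⁻¹ with hR
  have hR0 : 0 ≤ R := by positivity
  have hframe : ∀ y ∈ K, ∀ W : Fin 4 → E, IsONFrame (G y) W → ‖W‖ ≤ R ∧ ∀ i, ‖W i‖ ≤ R := by
    intro y hy W hW
    have hi : ∀ i, ‖W i‖ ≤ R := fun i ↦ hW.norm_le hlam (hlamK y hy) i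
    exact ⟨(pi_norm_le_iff_of_nonneg hR0).2 hi, hi⟩
  -- (2) geodesics with parallel frames, uniformly
  obtain ⟨ε, hε, L, hL, D₀, hD₀c, hD₀V, hsol⟩ := hG.exists_geodesicFrames (ι := Fin 4) hK hKV R
  -- (3) uniform continuity of the second covariant derivative on the compact state set
  have hΨc : ContinuousOn (cov2Arr G) D₀ := (continuousOn_cov2Arr hG).mono hD₀V
  have hΨu : UniformContinuousOn (cov2Arr G) D₀ := hD₀c.uniformContinuousOn_of_continuous hΨc
  set η' : ℝ := η / (8 * (‖Φ‖ + 1)) with hη'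
  have hη'pos : 0 < η' := by positivity
  obtain ⟨δ, hδ, hδu⟩ := Metric.uniformContinuousOn_iff_le.1 hΨu η' hη'pos
  -- (4) the bound `h₀`
  set h₀ : ℝ := min (ε ^ 2 / 16) ((δ / (L + 1)) ^ 2 / 8) with hh₀
  have hδL : 0 < δ / (L + 1) := div_pos hδ (by linarith)
  have hh₀pos : 0 < h₀ := lt_min (by positivity) (div_pos (pow_pos hδL 2) (by norm_num))
  refine ⟨h₀, hh₀pos, fun y hy W hW h hh C hC D hD hall ↦ ?_⟩
  -- trivial when `C = ∅`
  rcases C.eq_empty_or_nonempty with hCe | hCne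
  · rw [hCe, infDist_empty]; exact add_nonneg hD (mul_nonneg hh.1.le hη.le)
  -- (5) the parameter `s`: `s² = 8h`, `0 < s < ε`, `L s ≤ δ`
  have hhpos : 0 < h := hh.1
  set s : ℝ := Real.sqrt (8 * h) with hs
  have hs0 : 0 < s := Real.sqrt_pos.2 (by linarith)
  have hs2 : s ^ 2 = 8 * h := Real.sq_sqrt (by linarith)
  have hsε : s < ε := by
    rw [hs, Real.sqrt_lt' hε]
    have := hh.2.trans (min_le_left _ _)
    nlinarith
  have hLs : L * s ≤ δ := by
    have h1 : s ≤ δ / (L + 1) := by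
      rw [hs, ← Real.sqrt_sq hδL.le]
      refine Real.sqrt_le_sqrt ?_
      have := hh.2.trans (min_le_right _ _)
      linarith
    calc L * s ≤ L * (δ / (L + 1)) := by gcongr
      _ ≤ (L + 1) * (δ / (L + 1)) := by gcongr; linarith
      _ = δ := by field_simp
  have hIcc : Icc (-s) s ⊆ Icc (-ε) ε := Icc_subset_Icc (by linarith) hsε.le
  have hIoo : ∀ σ ∈ Icc (-s) s, Icc (-ε) ε ∈ 𝓝 σ := fun σ hσ ↦
    Icc_mem_nhds (by linarith [hσ.1]) (by linarith [hσ.2])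
  -- (6) the closed `D`-neighbourhood of `C`
  set CD : Set F := {p | infDist p C ≤ D} with hCD
  have hCDconv : Convex ℝ CD := convex_sublevel_infDist hC hCne D
  have hbv : Φ (rmComp G y W) ∈ CD := hall y (hKV hy) W hW
  have hCDne : CD.Nonempty := ⟨_, hbv⟩
  -- (7) the four curves
  obtain ⟨hWn, hWi⟩ := hframe y hy W hW
  have hex : ∀ i : Fin 4, ∃ q : ℝ → E × E × (Fin 4 → E), q 0 = (y, W i, W) ∧
      (∀ σ ∈ Icc (-ε) ε, HasDerivWithinAt q (geoField G (q σ)) (Icc (-ε) ε) σ) ∧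
      (∀ σ ∈ Icc (-ε) ε, q σ ∈ D₀) ∧ ∀ σ ∈ Icc (-ε) ε, ‖q σ - (y, W i, W)‖ ≤ L * |σ| := fun i ↦
    hsol (y, W i, W) hy (hWi i) hWn
  choose q hq0 hqd hqD hqL using hex
  -- the estimate for each curve
  have hcurve : ∀ i : Fin 4,
      infDist (Φ (rmComp G y W) + (s ^ 2 / 2) • Φ (cov2Arr G (y, W i, W))) CD ≤ (‖Φ‖ * η') * s ^ 2 := by
    intro i
    -- derivatives along the curve on `[-s, s]`
    have hder : ∀ σ ∈ Icc (-s) s, HasDerivAt (q i) (geoField G (q i σ)) σ := fun σ hσ ↦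
      (hqd i σ (hIcc hσ)).hasDerivAt (hIoo σ hσ)
    have hV : ∀ σ ∈ Icc (-s) s, (q i σ).1 ∈ V := fun σ hσ ↦ hD₀V (hqD i σ (hIcc hσ))
    -- orthonormality along the curve
    have hON : ∀ σ ∈ Icc (-s) s, IsONFrame (G (q i σ).1) (q i σ).2.2 := by
      intro σ hσ j k
      have hfd : ∀ τ ∈ Icc (-s) s,
          HasDerivAt (fun τ' ↦ G (q i τ').1 ((q i τ').2.2 j) ((q i τ').2.2 k)) 0 τ := by
        intro τ hτ
        obtain ⟨h1, -, h3⟩ := hasDerivAt_components (hder τ hτ)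
        exact hG.hasDerivAt_pairing_parallel (γ := fun τ' ↦ (q i τ').1) (u := fun τ' ↦ (q i τ').2.1)
          (W := fun τ' ↦ (q i τ').2.2) (hV τ hτ) h1 h3 j k
      have hdiff : DifferentiableOn ℝ (fun τ' ↦ G (q i τ').1 ((q i τ').2.2 j) ((q i τ').2.2 k))
          (Icc (-s) s) := fun τ hτ ↦ (hfd τ hτ).differentiableAt.differentiableWithinAt
      have hconst := constant_of_derivWithin_zero hdiff fun τ hτ ↦
        (hfd τ (Ico_subset_Icc_self hτ)).hasDerivWithinAt.derivWithin
          (uniqueDiffOn_Icc (by linarith) τ (Ico_subset_Icc_self hτ))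
      have h0mem : (0 : ℝ) ∈ Icc (-s) s := ⟨by linarith, hs0.le⟩
      have h0 := hconst 0 h0mem
      rw [hq0 i] at h0
      rw [hconst σ hσ, ← h0]
      exact hW j k
    -- the curve of readings and its derivatives
    let m : ℝ → F := fun τ ↦ Φ (rmComp G (q i τ).1 (q i τ).2.2)
    let m' : ℝ → F := fun τ ↦ Φ (fun a b c d ↦ G (q i τ).1
      (covRiemAt G (q i τ).1 (q i τ).2.1 ((q i τ).2.2 a) ((q i τ).2.2 b) ((q i τ).2.2 c)) ((q i τ).2.2 d))
    let m'' : ℝ → F := fun τ ↦ Φ (cov2Arr G (q i τ))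
    have hmd : ∀ τ ∈ Icc (-s) s, HasDerivAt m (m' τ) τ := by
      intro τ hτ
      obtain ⟨h1, -, h3⟩ := hasDerivAt_components (hder τ hτ)
      have hr : HasDerivAt (fun τ' ↦ rmComp G (q i τ').1 (q i τ').2.2) (fun a b c d ↦ G (q i τ).1
          (covRiemAt G (q i τ).1 (q i τ).2.1 ((q i τ).2.2 a) ((q i τ).2.2 b) ((q i τ).2.2 c))
          ((q i τ).2.2 d)) τ :=
        hasDerivAt_pi.2 fun a ↦ hasDerivAt_pi.2 fun b ↦ hasDerivAt_pi.2 fun c ↦ hasDerivAt_pi.2 fun d ↦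
          hG.hasDerivAt_rmComp_parallel (γ := fun τ' ↦ (q i τ').1) (u := fun τ' ↦ (q i τ').2.1)
            (W := fun τ' ↦ (q i τ').2.2) (hV τ hτ) h1 h3 a b c d
      exact Φ.hasFDerivAt.comp_hasDerivAt τ hr
    have hm'd : ∀ τ ∈ Icc (-s) s, HasDerivAt m' (m'' τ) τ := by
      intro τ hτ
      obtain ⟨h1, h2, h3⟩ := hasDerivAt_components (hder τ hτ)
      have hr : HasDerivAt (fun τ' ↦ (fun a b c d ↦ G (q i τ').1 (covRiemAt G (q i τ').1 (q i τ').2.1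
          ((q i τ').2.2 a) ((q i τ').2.2 b) ((q i τ').2.2 c)) ((q i τ').2.2 d) : Comp)) (cov2Arr G (q i τ)) τ :=
        hasDerivAt_pi.2 fun a ↦ hasDerivAt_pi.2 fun b ↦ hasDerivAt_pi.2 fun c ↦ hasDerivAt_pi.2 fun d ↦
          hG.hasDerivAt_covForm_parallel (γ := fun τ' ↦ (q i τ').1) (u := fun τ' ↦ (q i τ').2.1)
            (W := fun τ' ↦ (q i τ').2.2) (hV τ hτ) h1 h2 h3 a b c d
      exact Φ.hasFDerivAt.comp_hasDerivAt τ hr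
    -- the modulus of the second derivative
    have hω : ∀ τ ∈ Icc (-s) s, ‖m'' τ - m'' 0‖ ≤ ‖Φ‖ * η' := by
      intro τ hτ
      have h0mem : (0 : ℝ) ∈ Icc (-ε) ε := ⟨by linarith, hε.le⟩
      have hdist : dist (q i τ) (q i 0) ≤ δ := by
        rw [dist_eq_norm, hq0 i]
        calc ‖q i τ - (y, W i, W)‖ ≤ L * |τ| := hqL i τ (hIcc hτ)
          _ ≤ L * s := by gcongr; exact abs_le.2 ⟨by linarith [hτ.1], hτ.2⟩
          _ ≤ δ := hLs
      have hu := hδu (q i τ) (hqD i τ (hIcc hτ)) (q i 0) (hqD i 0 h0mem) hdist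
      rw [dist_eq_norm] at hu
      calc ‖m'' τ - m'' 0‖ = ‖Φ (cov2Arr G (q i τ) - cov2Arr G (q i 0))‖ := by simp only [m'', map_sub]
        _ ≤ ‖Φ‖ * ‖cov2Arr G (q i τ) - cov2Arr G (q i 0)‖ := Φ.le_opNorm _
        _ ≤ ‖Φ‖ * η' := by gcongr
    -- the end points lie in `CD`
    have hmem : ∀ τ ∈ Icc (-s) s, m τ ∈ CD := fun τ hτ ↦ hall _ (hV τ hτ) _ (hON τ hτ)
    have key := infDist_add_smul_le_of_midpoint hCDconv hs0.le hmd hm'd hω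
      (hmem s ⟨by linarith, le_rfl⟩) (hmem (-s) ⟨le_rfl, by linarith⟩)
    have hm0 : m 0 = Φ (rmComp G y W) := by simp only [m, hq0 i]
    have hm''0 : m'' 0 = Φ (cov2Arr G (y, W i, W)) := by simp only [m'', hq0 i]
    rw [hm0, hm''0] at key
    exact key
  -- (8) average over the four directions (Jensen for the distance to the convex set `CD`)
  set z : Fin 4 → F := fun i ↦ Φ (rmComp G y W) + (s ^ 2 / 2) • Φ (cov2Arr G (y, W i, W)) with hz
  have hw1 : ∑ _i : Fin 4, (1 / 4 : ℝ) = 1 := by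
    simp only [Finset.sum_const, Finset.card_univ, Fintype.card_fin, nsmul_eq_mul]; norm_num
  have hcm : Φ (rmComp G y W) + h • Φ (lapComp G y W) =
      Finset.univ.centerMass (fun _ ↦ (1 / 4 : ℝ)) z := by
    rw [Finset.centerMass_eq_of_sum_1 _ _ hw1, lapComp_eq_sum_cov2Arr, map_sum]
    simp only [hz, smul_add, smul_smul, Finset.sum_add_distrib, ← Finset.smul_sum, Finset.sum_const,
      Finset.card_univ, Fintype.card_fin]
    rw [← Nat.cast_smul_eq_nsmul ℝ, hs2, smul_smul]
    norm_num
    rw [show (1 / 4 : ℝ) * (8 * h / 2) = h by ring]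
  have hjensen := infDist_centerMass_le hCDconv hCDne Finset.univ (fun _ : Fin 4 ↦ (1 / 4 : ℝ))
    (fun _ _ ↦ by norm_num) (by rw [hw1]; exact one_pos) z
  have hsum : Finset.univ.centerMass (fun _ : Fin 4 ↦ (1 / 4 : ℝ)) (fun i ↦ infDist (z i) CD) ≤
      (‖Φ‖ * η') * s ^ 2 := by
    rw [Finset.centerMass_eq_of_sum_1 _ _ hw1]
    calc ∑ i : Fin 4, (1 / 4 : ℝ) • infDist (z i) CD ≤ ∑ _i : Fin 4, (1 / 4 : ℝ) • ((‖Φ‖ * η') * s ^ 2) :=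
          Finset.sum_le_sum fun i _ ↦ by
            simp only [smul_eq_mul]; exact mul_le_mul_of_nonneg_left (hcurve i) (by norm_num)
      _ = (‖Φ‖ * η') * s ^ 2 := by
          simp only [Finset.sum_const, Finset.card_univ, Fintype.card_fin, smul_eq_mul, nsmul_eq_mul]
          ring
  -- (9) conclusion
  have hfin : infDist (Φ (rmComp G y W) + h • Φ (lapComp G y W)) CD ≤ (‖Φ‖ * η') * s ^ 2 := by
    rw [hcm]; exact hjensen.trans hsum
  have hadd := infDist_le_infDist_sublevel_add (C := C) (p := Φ (rmComp G y W) + h • Φ (lapComp G y W))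
    (D := D) hCDne
  have hηbound : (‖Φ‖ * η') * s ^ 2 ≤ h * η := by
    rw [hs2, hη']
    have hΦ : 0 ≤ ‖Φ‖ := norm_nonneg _
    rw [show ‖Φ‖ * (η / (8 * (‖Φ‖ + 1))) * (8 * h) = h * η * (‖Φ‖ / (‖Φ‖ + 1)) by
      field_simp]
    have : ‖Φ‖ / (‖Φ‖ + 1) ≤ 1 := by
      rw [div_le_one (by positivity)]; linarith
    calc h * η * (‖Φ‖ / (‖Φ‖ + 1)) ≤ h * η * 1 := by gcongr
      _ = h * η := mul_one _
  linarith

end HamiltonMP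

end Literature.Geometry.Riemannian

end
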